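import Literature.NumberTheory.CubicFields.CubicFieldDiscriminant13523
import HarnessLib

/-!
# The cubic field of discriminant `−13523` (LMFDB 3.1.13523.1), part 2: the primes above `p ≤ 11` are principal — PROVED

Sequel of `CubicFieldDiscriminant13523.lean` (same seat, same namespace `Literature.NumberTheory.CubicFields.CubicDisc13523`; §1–§2 there: the polynomial,
`d_F = −13523`, `𝓞_F = ℤ[θ]`, signature).  THEOREMS ONLY; every statement PROVED.  §3 (first half, this file): the `θ`-relation and
every prime of `𝓞_F` above `p ≤ 11` is principal (explicit generators / inert primes, Dedekind–Kummer); the primes above `13 ≤ p ≤ 31` and §4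
(★ `h_F = 1` by Minkowski, `not_two_dvd_classNumber`) are in the sequel `CubicFieldDiscriminant13523ClassNumber.lean`.  Written by the prover seat `bsd-line-att-p4` g38 (cell `bsd-f1-sign2`; g27's template) for the curve `[1,0,0,−33,−76]` of conductor
`13523` (prime) on the doors-dead sub-cell (u1/u7) of crux C2 — the datum «`h(ℚ(β)) = 1`» of att-p3's / att-p5's class-group doors.

References: [LMFDB] number field 3.1.13523.1 (class number 1); [Marcus2018] Ch. 3 Thm. 27, Ch. 5 Thm. 37 and Cor. 2.
-/

noncomputable section

open Polynomial NumberField NumberField.InfinitePlace Ideal Module Real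
open Literature.NumberTheory.NumberFields
open Literature.NumberTheory.NumberFields.MonicCubic

namespace Literature.NumberTheory.CubicFields.CubicDisc13523

section NumberField

variable {F : Type*} [Field F] [NumberField F] {α : F}

/-! ## §3 The primes of norm `≤ 32` are principal -/

/-- The cubic relation `θ³ + aθ² + bθ + c = 0` in `𝓞_F`, numerals pushed (private helper). [folklore] -/
private theorem theta_rel (hα : aeval α (poly (-5) (-1) (-14)) = 0) :
    thetaInt hα ^ 3 + (-5) * thetaInt hα ^ 2 + (-1) * thetaInt hα + (-14) = 0 := by
  have h := thetaInt_rel hα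
  push_cast at h
  linear_combination h

/-- `(2, θ + 0) = (20 + 5 * θ + 8 * θ ^ 2)` (an element of norm `±2`). [cite: Marcus2018, Ch. 3, Thm. 27] -/
theorem span_2_lin0_eq (hα : aeval α (poly (-5) (-1) (-14)) = 0) :
    span {(2 : 𝓞 F), thetaInt hα} = span {20 + 5 * thetaInt hα + 8 * thetaInt hα ^ 2} := by
  have hrel := theta_rel hα
  apply le_antisymm
  · rw [span_le]
    rintro x hx
    rcases hx with rfl | hx
    · exact mem_span_singleton'.mpr ⟨19 - 9 * thetaInt hα + thetaInt hα ^ 2, by linear_combination (-27 + 8 * thetaInt hα) * hrel⟩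
    · rw [Set.mem_singleton_iff.mp hx]
      exact mem_span_singleton'.mpr ⟨7 + 10 * thetaInt hα - 2 * thetaInt hα ^ 2, by linear_combination (-10 - 16 * thetaInt hα) * hrel⟩
  · rw [span_singleton_le_iff_mem, mem_span_pair]
    exact ⟨45 + 8 * thetaInt hα + 19 * thetaInt hα ^ 2, -6 - 5 * thetaInt hα - 5 * thetaInt hα ^ 2, by linear_combination (-5) * hrel⟩

/-- `(2, θ² + 1θ + 1) = (-19 + 9 * θ - θ ^ 2)` (an element of norm `4`). [cite: Marcus2018, Ch. 3, Thm. 27] -/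
theorem span_2_quad_eq (hα : aeval α (poly (-5) (-1) (-14)) = 0) :
    span {(2 : 𝓞 F), thetaInt hα ^ 2 + thetaInt hα + 1} = span {-19 + 9 * thetaInt hα - thetaInt hα ^ 2} := by
  have hrel := theta_rel hα
  apply le_antisymm
  · rw [span_le]
    rintro x hx
    rcases hx with rfl | hx
    · exact mem_span_singleton'.mpr ⟨-20 - 5 * thetaInt hα - 8 * thetaInt hα ^ 2, by linear_combination (-27 + 8 * thetaInt hα) * hrel⟩
    · rw [Set.mem_singleton_iff.mp hx]
      exact mem_span_singleton'.mpr ⟨-381 - 95 * thetaInt hα - 153 * thetaInt hα ^ 2, by linear_combination (-517 + 153 * thetaInt hα) * hrel⟩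
  · rw [span_singleton_le_iff_mem, mem_span_pair]
    exact ⟨287 + 73 * thetaInt hα + 116 * thetaInt hα ^ 2, -5 - 6 * thetaInt hα - 6 * thetaInt hα ^ 2, by linear_combination (-42 - 6 * thetaInt hα) * hrel⟩

/-- **Every prime of `𝓞_F` above `2` is principal** (Dedekind–Kummer with `polyMod_2` and the generators above).
[cite: Marcus2018, Ch. 3, Thm. 27] [cite: LMFDB, number field 3.1.13523.1 (class number 1)] -/
theorem isPrincipal_of_mem_primesOver_2 (h3 : finrank ℚ F = 3) (hα : aeval α (poly (-5) (-1) (-14)) = 0) {P : Ideal (𝓞 F)}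
    (hP : P ∈ primesOver (span {((2 : ℕ) : ℤ)}) (𝓞 F)) : Submodule.IsPrincipal P := by
  haveI : Fact (Nat.Prime 2) := ⟨by norm_num⟩
  obtain ⟨Qb, hirr, hmon, hdvd, -, hspan⟩ :=
    exists_factor_of_mem_primesOver irreducible_polyQ hα h3 isUnit_of_disc_eq_sq_mul (by norm_num : Nat.Prime 2) hP
  rw [polyMod_2] at hdvd
  rcases hirr.prime.dvd_or_dvd hdvd with h | h
  · have hQb : Qb = X := eq_of_monic_of_associated hmon monic_X (hirr.associated_of_dvd irreducible_X h)
    have hPeq := hspan X (by rw [hQb, Polynomial.map_X])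
    rw [aeval_X, Nat.cast_ofNat, span_2_lin0_eq hα] at hPeq
    exact ⟨⟨20 + 5 * thetaInt hα + 8 * thetaInt hα ^ 2, by rw [hPeq, Ideal.submodule_span_eq]⟩⟩
  · have hQb : Qb = X ^ 2 + X + 1 :=
      eq_of_monic_of_associated hmon (by monicity!) (hirr.associated_of_dvd CubicDisc307.irreducible_quad_two h)
    have hPeq := hspan (X ^ 2 + X + 1) (by rw [hQb]; simp)
    rw [show aeval (thetaInt hα) (X ^ 2 + X + 1 : ℤ[X]) = thetaInt hα ^ 2 + thetaInt hα + 1 by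
        simp only [map_add, map_pow, aeval_X, map_one], Nat.cast_ofNat, span_2_quad_eq hα] at hPeq
    exact ⟨⟨-19 + 9 * thetaInt hα - thetaInt hα ^ 2, by rw [hPeq, Ideal.submodule_span_eq]⟩⟩

/-- **Every prime of `𝓞_F` above `3` is principal**: `3` is inert, the prime is `(3)`. [cite: Marcus2018, Ch. 3, Thm. 27] -/
theorem isPrincipal_of_mem_primesOver_3 (h3 : finrank ℚ F = 3) (hα : aeval α (poly (-5) (-1) (-14)) = 0) {P : Ideal (𝓞 F)}
    (hP : P ∈ primesOver (span {((3 : ℕ) : ℤ)}) (𝓞 F)) : Submodule.IsPrincipal P := by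
  have hPeq := eq_span_of_no_root irreducible_polyQ hα h3 isUnit_of_disc_eq_sq_mul (by norm_num : Nat.Prime 3) hP no_root_3
  exact ⟨⟨((3 : ℕ) : 𝓞 F), by rw [hPeq, Ideal.submodule_span_eq]⟩⟩

/-- `(5, θ + 2) = (1587 - 2334 * θ + 365 * θ ^ 2)` (an element of norm `±5`). [cite: Marcus2018, Ch. 3, Thm. 27] -/
theorem span_5_lin2_eq (hα : aeval α (poly (-5) (-1) (-14)) = 0) :
    span {(5 : 𝓞 F), thetaInt hα + 2} = span {1587 - 2334 * thetaInt hα + 365 * thetaInt hα ^ 2} := by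
  have hrel := theta_rel hα
  apply le_antisymm
  · rw [span_le]
    rintro x hx
    rcases hx with rfl | hx
    · exact mem_span_singleton'.mpr ⟨1184373 + 295303 * thetaInt hα + 475526 * thetaInt hα ^ 2, by linear_combination (-134257139 + 173566990 * thetaInt hα) * hrel⟩
    · rw [Set.mem_singleton_iff.mp hx]
      exact mem_span_singleton'.mpr ⟨1805222 + 450101 * thetaInt hα + 724797 * thetaInt hα ^ 2, by linear_combination (-204634808 + 264550905 * thetaInt hα) * hrel⟩
  · rw [span_singleton_le_iff_mem, mem_span_pair]
    exact ⟨331 - 464 * thetaInt hα + 79 * thetaInt hα ^ 2, -6 - 2 * thetaInt hα - 4 * thetaInt hα ^ 2, by linear_combination (-4) * hrel⟩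

/-- `(5, θ² + 3θ + 3) = (1 + 101 * θ - 18 * θ ^ 2)` (an element of norm `25`). [cite: Marcus2018, Ch. 3, Thm. 27] -/
theorem span_5_quad_eq (hα : aeval α (poly (-5) (-1) (-14)) = 0) :
    span {(5 : 𝓞 F), thetaInt hα ^ 2 + 3 * thetaInt hα + 3} = span {1 + 101 * thetaInt hα - 18 * thetaInt hα ^ 2} := by
  have hrel := theta_rel hα
  apply le_antisymm
  · rw [span_le]
    rintro x hx
    rcases hx with rfl | hx
    · exact mem_span_singleton'.mpr ⟨-401 - 100 * thetaInt hα - 161 * thetaInt hα ^ 2, by linear_combination (29 + 2898 * thetaInt hα) * hrel⟩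
    · rw [Set.mem_singleton_iff.mp hx]
      exact mem_span_singleton'.mpr ⟨-4127 - 1029 * thetaInt hα - 1657 * thetaInt hα ^ 2, by linear_combination (295 + 29826 * thetaInt hα) * hrel⟩
  · rw [span_singleton_le_iff_mem, mem_span_pair]
    exact ⟨155 + 55 * thetaInt hα + 60 * thetaInt hα ^ 2, -6 - 6 * thetaInt hα - 6 * thetaInt hα ^ 2, by linear_combination (-54 - 6 * thetaInt hα) * hrel⟩

/-- **Every prime of `𝓞_F` above `5` is principal** (Dedekind–Kummer with `polyMod_5` and the generators above).
[cite: Marcus2018, Ch. 3, Thm. 27] [cite: LMFDB, number field 3.1.13523.1 (class number 1)] -/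
theorem isPrincipal_of_mem_primesOver_5 (h3 : finrank ℚ F = 3) (hα : aeval α (poly (-5) (-1) (-14)) = 0) {P : Ideal (𝓞 F)}
    (hP : P ∈ primesOver (span {((5 : ℕ) : ℤ)}) (𝓞 F)) : Submodule.IsPrincipal P := by
  haveI : Fact (Nat.Prime 5) := ⟨by norm_num⟩
  obtain ⟨Qb, hirr, hmon, hdvd, -, hspan⟩ :=
    exists_factor_of_mem_primesOver irreducible_polyQ hα h3 isUnit_of_disc_eq_sq_mul (by norm_num : Nat.Prime 5) hP
  rw [polyMod_5] at hdvd
  rcases hirr.prime.dvd_or_dvd hdvd with h | h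
  · have hirr1 : Irreducible (X + 2 : (ZMod 5)[X]) := by
      rw [show (X + 2 : (ZMod 5)[X]) = X - C (-2) by rw [map_neg, map_ofNat]; ring]
      exact irreducible_X_sub_C _
    have hQb : Qb = X + 2 := eq_of_monic_of_associated hmon (by monicity!) (hirr.associated_of_dvd hirr1 h)
    have hPeq := hspan (X + C 2) (by rw [hQb]; simp [map_ofNat])
    rw [show aeval (thetaInt hα) (X + C 2 : ℤ[X]) = thetaInt hα + 2 by
        simp only [map_add, aeval_X, aeval_C, algebraMap_int_eq, Int.coe_castRingHom, Int.cast_ofNat], Nat.cast_ofNat, span_5_lin2_eq hα] at hPeq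
    exact ⟨⟨1587 - 2334 * thetaInt hα + 365 * thetaInt hα ^ 2, by rw [hPeq, Ideal.submodule_span_eq]⟩⟩
  · have hQb : Qb = X ^ 2 + 3 * X + 3 :=
      eq_of_monic_of_associated hmon (by monicity!) (hirr.associated_of_dvd CubicDisc3027.irreducible_quad_5 h)
    have hPeq := hspan (X ^ 2 + C 3 * X + C 3) (by rw [hQb]; simp [map_ofNat])
    rw [show aeval (thetaInt hα) (X ^ 2 + C 3 * X + C 3 : ℤ[X]) = thetaInt hα ^ 2 + 3 * thetaInt hα + 3 by
        simp only [map_add, map_mul, map_pow, aeval_X, aeval_C, algebraMap_int_eq, Int.coe_castRingHom, Int.cast_ofNat], Nat.cast_ofNat, span_5_quad_eq hα] at hPeq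
    exact ⟨⟨1 + 101 * thetaInt hα - 18 * thetaInt hα ^ 2, by rw [hPeq, Ideal.submodule_span_eq]⟩⟩

/-- `(7, θ + 0) = (-7 - 10 * θ + 2 * θ ^ 2)` (an element of norm `±7`). [cite: Marcus2018, Ch. 3, Thm. 27] -/
theorem span_7_lin0_eq (hα : aeval α (poly (-5) (-1) (-14)) = 0) :
    span {(7 : 𝓞 F), thetaInt hα} = span {-7 - 10 * thetaInt hα + 2 * thetaInt hα ^ 2} := by
  have hrel := theta_rel hα
  apply le_antisymm
  · rw [span_le]
    rintro x hx
    rcases hx with rfl | hx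
    · exact mem_span_singleton'.mpr ⟨-25 - 6 * thetaInt hα - 10 * thetaInt hα ^ 2, by linear_combination (-12 - 20 * thetaInt hα) * hrel⟩
    · rw [Set.mem_singleton_iff.mp hx]
      exact mem_span_singleton'.mpr ⟨-20 - 5 * thetaInt hα - 8 * thetaInt hα ^ 2, by linear_combination (-10 - 16 * thetaInt hα) * hrel⟩
  · rw [span_singleton_le_iff_mem, mem_span_pair]
    exact ⟨7 + 4 * thetaInt hα ^ 2, -6 - 6 * thetaInt hα - 4 * thetaInt hα ^ 2, by linear_combination (-4) * hrel⟩

/-- `(7, θ + 5) = (-103 - 229 * θ + 44 * θ ^ 2)` (an element of norm `±7`). [cite: Marcus2018, Ch. 3, Thm. 27] -/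
theorem span_7_lin5_eq (hα : aeval α (poly (-5) (-1) (-14)) = 0) :
    span {(7 : 𝓞 F), thetaInt hα + 5} = span {-103 - 229 * thetaInt hα + 44 * thetaInt hα ^ 2} := by
  have hrel := theta_rel hα
  apply le_antisymm
  · rw [span_le]
    rintro x hx
    rcases hx with rfl | hx
    · exact mem_span_singleton'.mpr ⟨-11599 - 2892 * thetaInt hα - 4657 * thetaInt hα ^ 2, by linear_combination (-85335 - 204908 * thetaInt hα) * hrel⟩
    · rw [Set.mem_singleton_iff.mp hx]
      exact mem_span_singleton'.mpr ⟨-17599 - 4388 * thetaInt hα - 7066 * thetaInt hα ^ 2, by linear_combination (-129478 - 310904 * thetaInt hα) * hrel⟩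
  · rw [span_singleton_le_iff_mem, mem_span_pair]
    exact ⟨-10 - 28 * thetaInt hα + 10 * thetaInt hα ^ 2, -1 - 6 * thetaInt hα - 2 * thetaInt hα ^ 2, by linear_combination (-2) * hrel⟩

/-- `(7, θ + 4) = (51 + 64 * θ - 13 * θ ^ 2)` (an element of norm `±7`). [cite: Marcus2018, Ch. 3, Thm. 27] -/
theorem span_7_lin4_eq (hα : aeval α (poly (-5) (-1) (-14)) = 0) :
    span {(7 : 𝓞 F), thetaInt hα + 4} = span {51 + 64 * thetaInt hα - 13 * thetaInt hα ^ 2} := by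
  have hrel := theta_rel hα
  apply le_antisymm
  · rw [span_le]
    rintro x hx
    rcases hx with rfl | hx
    · exact mem_span_singleton'.mpr ⟨1071 + 267 * thetaInt hα + 430 * thetaInt hα ^ 2, by linear_combination (-3901 - 5590 * thetaInt hα) * hrel⟩
    · rw [Set.mem_singleton_iff.mp hx]
      exact mem_span_singleton'.mpr ⟨1472 + 367 * thetaInt hα + 591 * thetaInt hα ^ 2, by linear_combination (-5362 - 7683 * thetaInt hα) * hrel⟩
  · rw [span_singleton_le_iff_mem, mem_span_pair]
    exact ⟨9 + 13 * thetaInt hα - thetaInt hα ^ 2, -3 - 6 * thetaInt hα, by linear_combination ((0 : 𝓞 F)) * hrel⟩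

/-- **Every prime of `𝓞_F` above `7` is principal** (Dedekind–Kummer with `polyMod_7` and the generators above).
[cite: Marcus2018, Ch. 3, Thm. 27] [cite: LMFDB, number field 3.1.13523.1 (class number 1)] -/
theorem isPrincipal_of_mem_primesOver_7 (h3 : finrank ℚ F = 3) (hα : aeval α (poly (-5) (-1) (-14)) = 0) {P : Ideal (𝓞 F)}
    (hP : P ∈ primesOver (span {((7 : ℕ) : ℤ)}) (𝓞 F)) : Submodule.IsPrincipal P := by
  haveI : Fact (Nat.Prime 7) := ⟨by norm_num⟩
  obtain ⟨Qb, hirr, hmon, hdvd, -, hspan⟩ :=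
    exists_factor_of_mem_primesOver irreducible_polyQ hα h3 isUnit_of_disc_eq_sq_mul (by norm_num : Nat.Prime 7) hP
  rw [polyMod_7] at hdvd
  rcases hirr.prime.dvd_or_dvd hdvd with h12 | h
  · rcases hirr.prime.dvd_or_dvd h12 with h | h
    · have hQb : Qb = X := eq_of_monic_of_associated hmon monic_X (hirr.associated_of_dvd irreducible_X h)
      have hPeq := hspan X (by rw [hQb, Polynomial.map_X])
      rw [aeval_X, Nat.cast_ofNat, span_7_lin0_eq hα] at hPeq
      exact ⟨⟨-7 - 10 * thetaInt hα + 2 * thetaInt hα ^ 2, by rw [hPeq, Ideal.submodule_span_eq]⟩⟩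
    · have hirr1 : Irreducible (X + 5 : (ZMod 7)[X]) := by
        rw [show (X + 5 : (ZMod 7)[X]) = X - C (-5) by rw [map_neg, map_ofNat]; ring]
        exact irreducible_X_sub_C _
      have hQb : Qb = X + 5 := eq_of_monic_of_associated hmon (by monicity!) (hirr.associated_of_dvd hirr1 h)
      have hPeq := hspan (X + C 5) (by rw [hQb]; simp [map_ofNat])
      rw [show aeval (thetaInt hα) (X + C 5 : ℤ[X]) = thetaInt hα + 5 by
          simp only [map_add, aeval_X, aeval_C, algebraMap_int_eq, Int.coe_castRingHom, Int.cast_ofNat], Nat.cast_ofNat, span_7_lin5_eq hα] at hPeq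
      exact ⟨⟨-103 - 229 * thetaInt hα + 44 * thetaInt hα ^ 2, by rw [hPeq, Ideal.submodule_span_eq]⟩⟩
  · have hirr1 : Irreducible (X + 4 : (ZMod 7)[X]) := by
      rw [show (X + 4 : (ZMod 7)[X]) = X - C (-4) by rw [map_neg, map_ofNat]; ring]
      exact irreducible_X_sub_C _
    have hQb : Qb = X + 4 := eq_of_monic_of_associated hmon (by monicity!) (hirr.associated_of_dvd hirr1 h)
    have hPeq := hspan (X + C 4) (by rw [hQb]; simp [map_ofNat])
    rw [show aeval (thetaInt hα) (X + C 4 : ℤ[X]) = thetaInt hα + 4 by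
        simp only [map_add, aeval_X, aeval_C, algebraMap_int_eq, Int.coe_castRingHom, Int.cast_ofNat], Nat.cast_ofNat, span_7_lin4_eq hα] at hPeq
    exact ⟨⟨51 + 64 * thetaInt hα - 13 * thetaInt hα ^ 2, by rw [hPeq, Ideal.submodule_span_eq]⟩⟩

/-- `(11, θ + 4) = (-5 - θ - 2 * θ ^ 2)` (an element of norm `±11`). [cite: Marcus2018, Ch. 3, Thm. 27] -/
theorem span_11_lin4_eq (hα : aeval α (poly (-5) (-1) (-14)) = 0) :
    span {(11 : 𝓞 F), thetaInt hα + 4} = span {-5 - thetaInt hα - 2 * thetaInt hα ^ 2} := by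
  have hrel := theta_rel hα
  apply le_antisymm
  · rw [span_le]
    rintro x hx
    rcases hx with rfl | hx
    · exact mem_span_singleton'.mpr ⟨-5 - 16 * thetaInt hα + 3 * thetaInt hα ^ 2, by linear_combination (-1 - 6 * thetaInt hα) * hrel⟩
    · rw [Set.mem_singleton_iff.mp hx]
      exact mem_span_singleton'.mpr ⟨2 - 6 * thetaInt hα + thetaInt hα ^ 2, by linear_combination (1 - 2 * thetaInt hα) * hrel⟩
  · rw [span_singleton_le_iff_mem, mem_span_pair]
    exact ⟨3 + 2 * thetaInt hα + thetaInt hα ^ 2, -6 - 4 * thetaInt hα - thetaInt hα ^ 2, by linear_combination (-1) * hrel⟩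

/-- **Every prime of `𝓞_F` above `11` with `11^f ≤ 32` is principal** (Dedekind–Kummer with `polyMod_11` and the generators above).
[cite: Marcus2018, Ch. 3, Thm. 27] [cite: LMFDB, number field 3.1.13523.1 (class number 1)] -/
theorem isPrincipal_of_mem_primesOver_11 (h3 : finrank ℚ F = 3) (hα : aeval α (poly (-5) (-1) (-14)) = 0) {P : Ideal (𝓞 F)}
    (hP : P ∈ primesOver (span {((11 : ℕ) : ℤ)}) (𝓞 F))
    (hle : 11 ^ P.inertiaDeg ℤ ≤ 32) : Submodule.IsPrincipal P := by
  haveI : Fact (Nat.Prime 11) := ⟨by norm_num⟩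
  obtain ⟨Qb, hirr, hmon, hdvd, hdeg, hspan⟩ :=
    exists_factor_of_mem_primesOver irreducible_polyQ hα h3 isUnit_of_disc_eq_sq_mul (by norm_num : Nat.Prime 11) hP
  rw [polyMod_11] at hdvd
  rcases hirr.prime.dvd_or_dvd hdvd with h | h
  · have hirr1 : Irreducible (X + 4 : (ZMod 11)[X]) := by
      rw [show (X + 4 : (ZMod 11)[X]) = X - C (-4) by rw [map_neg, map_ofNat]; ring]
      exact irreducible_X_sub_C _
    have hQb : Qb = X + 4 := eq_of_monic_of_associated hmon (by monicity!) (hirr.associated_of_dvd hirr1 h)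
    have hPeq := hspan (X + C 4) (by rw [hQb]; simp [map_ofNat])
    rw [show aeval (thetaInt hα) (X + C 4 : ℤ[X]) = thetaInt hα + 4 by
        simp only [map_add, aeval_X, aeval_C, algebraMap_int_eq, Int.coe_castRingHom, Int.cast_ofNat], Nat.cast_ofNat, span_11_lin4_eq hα] at hPeq
    exact ⟨⟨-5 - thetaInt hα - 2 * thetaInt hα ^ 2, by rw [hPeq, Ideal.submodule_span_eq]⟩⟩
  · have hQb : Qb = X ^ 2 + 2 * X + 2 :=
      eq_of_monic_of_associated hmon (by monicity!) (hirr.associated_of_dvd irreducible_quad_11 h)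
    exfalso
    have hd2 : (X ^ 2 + 2 * X + 2 : (ZMod 11)[X]).natDegree = 2 := by compute_degree!
    rw [hdeg, hQb, hd2] at hle
    norm_num at hle

end NumberField

end Literature.NumberTheory.CubicFields.CubicDisc13523

end
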